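import Summits.Ventures.Crystal3D.Theorems.StickyWulffConstantTextureLiminfCellFluxMargin
import Summits.Ventures.Crystal3D.Theorems.StickyWulffConstantTextureLiminfFluxCountSel
import HarnessLib

/-!
# The wall cell's charge against the plates' zigzag lines, for ABSTRACT step selectors (both radii forms)
# (lane T, the T-side port of lane G's walker ledger; crux `TextureLiminf`, stmt-Ventures-19483)

HONEST FRAMING. Venture `Summits/Ventures/Crystal3D` (cell `crystal3d-full`), helper `--supports` the crux
`TextureLiminf` (stmt-Ventures-19483) of `route-Ventures-StickyWulffConstant`, registered line `TexShadow` (v6.7; cf-p1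
ROUTE.md §86(61) BD ruling: abstract step selector, so lane G's walk machine instantiates with its own tie-break).
Rung credit only; F-C1 not moved.  NOT the wall law.

Verbatim `cell_charge_le_lines` (`…CellFlux`) and `cell_charge_le_lines_margin` (`…CellFluxMargin`) with the two plates'
polylines `zigVertexS step₁`, `zigVertexS step₂` for any selectors `IsZigSelector L₁ σ₁ e₃ step₁`,
`IsZigSelector L₂ σ₂ (−e₃) step₂`:

* **`cell_charge_le_lines_sel`** — for every flux-dominated table `c ≥ 0`: `2·Q_ρ(c) ≤ #T₁ + #T₂ + 80(R₀+9)(1+h)ρ`, with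
  `T₁ ⊇` the bottom plate's selector lines with a site in `{−R₀−4 ≤ z ≤ −R₀−3} × disc ρ`, `T₂ ⊇` the top plate's with a site
  in `{h+R₀+3 ≤ z ≤ h+R₀+4} × disc ρ`;
* **`cell_charge_le_lines_margin_sel`** — the same with windows of lateral radius `ρ − m` (inner launch disc), `+ 18·m·ρ`.
F4 (19480-p2): with `step :=` the machine's selector (`v₀` on Δ-bilayers, `basalMirror (bestCapper …)` on ∇) and its CAP-START
families indexed by `T₁`, `T₂`: `#T₁ + #T₂ ≤ Σ_PAY (12 − deg) + C(1+h)ρ` then closes `BilayerWallCovered` through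
`bilayerWallAt_of_payerBound` (`…BilayerWallBookkeeping`).
WHAT THIS IS NOT: not the walker family; F-C1 not moved.
-/

noncomputable section

namespace Summit.Ventures.Crystal3D.Theorems

open MeasureTheory Set
open scoped ENNReal InnerProductSpace
open Literature.MathematicalPhysics.StatisticalMechanics (IsHaggSeq triangularVec₁ triangularVec₂)
open Summit.Ventures.Crystal3D.Cruxes.TextureLiminf.TexShadow (E3 e₃ laySlab bilayerRise PlateLaunchable plateFlux
  FluxDominated)

/-- **The wall cell's charge is at most the two plates' zigzag line counts.**  See the module docstring. -/
theorem cell_charge_le_lines_sel {σ₁ σ₂ : ℤ → ℤ} (hσ₁ : IsHaggSeq σ₁) (hσ₂ : IsHaggSeq σ₂)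
    (L₁ L₂ : E3 ≃ₗᵢ[ℝ] E3) (s₁ s₂ : E3) (τ₀ R₀ h ρ : ℝ) (hR₀ : 1 ≤ R₀) (hh : 0 ≤ h) (hρ : 0 ≤ ρ)
    (c : ℤ → ℤ → ℝ) (hc0 : ∀ i j, 0 ≤ c i j) (hdom : FluxDominated τ₀ L₁ σ₁ L₂ σ₂ c)
    {step₁ : ℤ → E3} (hsel₁ : IsZigSelector L₁ σ₁ e₃ step₁) {step₂ : ℤ → E3} (hsel₂ : IsZigSelector L₂ σ₂ (-e₃) step₂)
    (T₁ T₂ : Finset (Fin 2 → ℤ))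
    (hT₁ : ∀ t : Fin 2 → ℤ, (∃ k : ℤ,
        -R₀ - 4 ≤ (L₁ (zigVertexS step₁ k + ((t 0 : ℝ) • triangularVec₁ 1 + (t 1 : ℝ) • triangularVec₂ 1)) + s₁) 2 ∧
        (L₁ (zigVertexS step₁ k + ((t 0 : ℝ) • triangularVec₁ 1 + (t 1 : ℝ) • triangularVec₂ 1)) + s₁) 2 ≤ -R₀ - 3 ∧
        Real.sqrt ((L₁ (zigVertexS step₁ k + ((t 0 : ℝ) • triangularVec₁ 1 + (t 1 : ℝ) • triangularVec₂ 1)) + s₁) 0 ^ 2 +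
          (L₁ (zigVertexS step₁ k + ((t 0 : ℝ) • triangularVec₁ 1 + (t 1 : ℝ) • triangularVec₂ 1)) + s₁) 1 ^ 2) ≤ ρ) →
        t ∈ T₁)
    (hT₂ : ∀ t : Fin 2 → ℤ, (∃ k : ℤ,
        h + R₀ + 3 ≤ (L₂ (zigVertexS step₂ k + ((t 0 : ℝ) • triangularVec₁ 1 + (t 1 : ℝ) • triangularVec₂ 1)) + s₂) 2 ∧
        (L₂ (zigVertexS step₂ k + ((t 0 : ℝ) • triangularVec₁ 1 + (t 1 : ℝ) • triangularVec₂ 1)) + s₂) 2 ≤ h + R₀ + 4 ∧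
        Real.sqrt ((L₂ (zigVertexS step₂ k + ((t 0 : ℝ) • triangularVec₁ 1 + (t 1 : ℝ) • triangularVec₂ 1)) + s₂) 0 ^ 2 +
          (L₂ (zigVertexS step₂ k + ((t 0 : ℝ) • triangularVec₁ 1 + (t 1 : ℝ) • triangularVec₂ 1)) + s₂) 1 ^ 2) ≤ ρ) →
        t ∈ T₂) :
    2 * ∑' ij : ℤ × ℤ, c ij.1 ij.2 * (volume (wallSlice ρ ∩ laySlab L₁ s₁ ij.1 ∩ laySlab L₂ s₂ ij.2)).toReal ≤
      (T₁.card : ℝ) + T₂.card + 80 * (R₀ + 9) * (1 + h) * ρ := by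
  have he₃ : ‖(e₃ : E3)‖ = 1 := by rw [e₃, PiLp.norm_single, norm_one]
  have hne₃ : ‖(-e₃ : E3)‖ = 1 := by rw [norm_neg, he₃]
  have hi₃ : ∀ p : E3, ⟪p, e₃⟫_ℝ = p 2 := fun p => by
    rw [e₃, EuclideanSpace.inner_single_right]; simp
  -- the table is bounded by `√2`
  have hcB : ∀ i j, c i j ≤ Real.sqrt 2 := fun i j =>
    (hdom i j).trans (by linarith [plateFlux_le_sqrt_two τ₀ L₁ σ₁ he₃ i, plateFlux_le_sqrt_two τ₀ L₂ σ₂ hne₃ j])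
  have hs2 : 0 ≤ Real.sqrt 2 := Real.sqrt_nonneg 2
  have h418 := four_sqrt_two_pi_le
  have hπ0 := Real.pi_pos.le
  set d : ℝ := 4 * h + 4 * R₀ + 36 with hd
  have hd0 : 0 ≤ d := by rw [hd]; positivity
  have hdle : d ≤ 4 * (R₀ + 9) * (1 + h) := by rw [hd]; nlinarith
  have hT0 : (0 : ℝ) ≤ (T₁.card : ℝ) + T₂.card := by positivity
  -- finiteness of slices
  have hSfin : ∀ r, 0 ≤ r → volume (wallSlice r) ≠ ⊤ := fun r hr => by rw [volume_wallSlice r hr]; exact ENNReal.ofReal_ne_top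
  by_cases hsmall : ρ ≤ d
  · -- degenerate: the whole slice is rim
    have h1 := two_charge_le_const L₁ L₂ s₁ s₂ c (Real.sqrt 2) hc0 hcB (wallSlice ρ) (measurableSet_wallSlice ρ) (hSfin ρ hρ)
    rw [volume_wallSlice ρ hρ, ENNReal.toReal_ofReal (by positivity)] at h1
    have h2 : Real.pi * ρ ^ 2 ≤ Real.pi * (ρ * d) := mul_le_mul_of_nonneg_left (by nlinarith) hπ0
    have h3 : 2 * Real.sqrt 2 * (Real.pi * (ρ * d)) ≤ 80 * (R₀ + 9) * (1 + h) * ρ := by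
      have : 2 * Real.sqrt 2 * (Real.pi * (ρ * d)) = (2 * Real.sqrt 2 * Real.pi) * d * ρ := by ring
      rw [this]
      have h4 : 2 * Real.sqrt 2 * Real.pi ≤ 9 := by linarith
      have h5 : (2 * Real.sqrt 2 * Real.pi) * d ≤ 9 * (4 * (R₀ + 9) * (1 + h)) :=
        mul_le_mul h4 hdle hd0 (by norm_num)
      nlinarith
    nlinarith [mul_le_mul_of_nonneg_left h2 (by positivity : 0 ≤ 2 * Real.sqrt 2)]
  -- the shrunken slice and the annulus
  push Not at hsmall
  set ρ' : ℝ := ρ - d with hρ'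
  have hρ'0 : 0 ≤ ρ' := by rw [hρ']; linarith
  have hρ'ρ : ρ' ≤ ρ := by rw [hρ']; linarith
  set S : Set E3 := wallSlice ρ with hS
  set S' : Set E3 := wallSlice ρ' with hS'
  set ann : Set E3 := S \ S' with hann
  have hS'S : S' ⊆ S := wallSlice_mono hρ'ρ hρ'0
  have hSm : MeasurableSet S := measurableSet_wallSlice ρ
  have hS'm : MeasurableSet S' := measurableSet_wallSlice ρ'
  have hannm : MeasurableSet ann := hSm.diff hS'm
  have hannfin : volume ann ≠ ⊤ := ne_top_of_le_ne_top (hSfin ρ hρ) (measure_mono Set.sdiff_subset)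
  -- split the charge
  set f : Set E3 → ℤ × ℤ → ℝ := fun X ij => c ij.1 ij.2 * (volume (X ∩ laySlab L₁ s₁ ij.1 ∩ laySlab L₂ s₂ ij.2)).toReal with hf
  have hsplit : ∀ ij, f S ij = f S' ij + f ann ij := by
    intro ij
    simp only [hf]
    have hset : S ∩ laySlab L₁ s₁ ij.1 ∩ laySlab L₂ s₂ ij.2 =
        (S' ∩ laySlab L₁ s₁ ij.1 ∩ laySlab L₂ s₂ ij.2) ∪ (ann ∩ laySlab L₁ s₁ ij.1 ∩ laySlab L₂ s₂ ij.2) := by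
      rw [← Set.union_inter_distrib_right, ← Set.union_inter_distrib_right, hann, Set.union_sdiff_cancel hS'S]
    have hdisj : Disjoint (S' ∩ laySlab L₁ s₁ ij.1 ∩ laySlab L₂ s₂ ij.2) (ann ∩ laySlab L₁ s₁ ij.1 ∩ laySlab L₂ s₂ ij.2) :=
      (Set.disjoint_sdiff_right).mono (Set.inter_subset_left.trans Set.inter_subset_left)
        (Set.inter_subset_left.trans Set.inter_subset_left)
    rw [hset, measure_union hdisj ((hannm.inter (measurableSet_laySlab L₁ s₁ _)).inter (measurableSet_laySlab L₂ s₂ _)),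
      ENNReal.toReal_add (ne_top_of_le_ne_top (hSfin ρ' hρ'0) (measure_mono (Set.inter_subset_left.trans Set.inter_subset_left)))
        (ne_top_of_le_ne_top hannfin (measure_mono (Set.inter_subset_left.trans Set.inter_subset_left))), mul_add]
  have hsumS' := summable_charge L₁ L₂ s₁ s₂ c (Real.sqrt 2) hc0 hcB S' hS'm (hSfin ρ' hρ'0)
  have hsumA := summable_charge L₁ L₂ s₁ s₂ c (Real.sqrt 2) hc0 hcB ann hannm hannfin
  have hQ : ∑' ij, f S ij = ∑' ij, f S' ij + ∑' ij, f ann ij := by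
    rw [← hsumS'.tsum_add hsumA]; exact tsum_congr hsplit
  -- the shrunken slice: flux
  have hdomκ : ∀ i j, c i j ≤ (plateFlux τ₀ L₁ σ₁ e₃ i + plateFlux τ₀ L₂ σ₂ (-e₃) j) / 2 := hdom
  have hflux := charge_le_flux L₁ L₂ s₁ s₂ (plateFlux τ₀ L₁ σ₁ e₃) (plateFlux τ₀ L₂ σ₂ (-e₃)) c (Real.sqrt 2)
    (plateFlux_nonneg τ₀ L₁ σ₁ he₃) (plateFlux_le_sqrt_two τ₀ L₁ σ₁ he₃) (plateFlux_nonneg τ₀ L₂ σ₂ hne₃)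
    (plateFlux_le_sqrt_two τ₀ L₂ σ₂ hne₃) hc0 hdomκ S' hS'm (hSfin ρ' hρ'0)
  -- plate 1
  have hS'sub₁ : S' ⊆ {p : E3 | (0 : ℝ) ≤ ⟪p, e₃⟫_ℝ ∧ ⟪p, e₃⟫_ℝ ≤ 0 + 1 ∧ Real.sqrt (p 0 ^ 2 + p 1 ^ 2) ≤ ρ'} := by
    rintro p ⟨h1, h2, h3⟩
    refine ⟨by rw [hi₃]; exact h1, by rw [hi₃]; linarith, ?_⟩
    rw [← Real.sqrt_sq hρ'0]; exact Real.sqrt_le_sqrt h3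
  have hP₁ := plate_lines_ge_flux_sel hσ₁ L₁ s₁ e₃ he₃ hsel₁ τ₀ ρ' 0 (-R₀ - 4) (by linarith) S' hS'm (hSfin ρ' hρ'0) hS'sub₁ T₁
    (fun t ⟨k, hk1, hk2, hk3⟩ => hT₁ t ⟨k, by rw [hi₃] at hk1; linarith, by rw [hi₃] at hk2; linarith,
      hk3.trans (by rw [hρ', hd]; linarith)⟩)
  -- plate 2
  have hS'sub₂ : S' ⊆ {p : E3 | (-1 : ℝ) ≤ ⟪p, -e₃⟫_ℝ ∧ ⟪p, -e₃⟫_ℝ ≤ -1 + 1 ∧ Real.sqrt (p 0 ^ 2 + p 1 ^ 2) ≤ ρ'} := by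
    rintro p ⟨h1, h2, h3⟩
    refine ⟨by rw [inner_neg_right, hi₃]; linarith, by rw [inner_neg_right, hi₃]; linarith, ?_⟩
    rw [← Real.sqrt_sq hρ'0]; exact Real.sqrt_le_sqrt h3
  have hP₂ := plate_lines_ge_flux_sel hσ₂ L₂ s₂ (-e₃) hne₃ hsel₂ τ₀ ρ' (-1) (-h - R₀ - 4) (by linarith) S' hS'm (hSfin ρ' hρ'0)
    hS'sub₂ T₂ (fun t ⟨k, hk1, hk2, hk3⟩ => hT₂ t ⟨k, by rw [inner_neg_right, hi₃] at hk2; linarith,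
      by rw [inner_neg_right, hi₃] at hk1; linarith, hk3.trans (by rw [hρ', hd]; linarith)⟩)
  -- the annulus
  have hA := two_charge_le_const L₁ L₂ s₁ s₂ c (Real.sqrt 2) hc0 hcB ann hannm hannfin
  have hvolann : (volume ann).toReal = Real.pi * ρ ^ 2 - Real.pi * ρ' ^ 2 := by
    have hu : volume S = volume S' + volume ann := by
      rw [← measure_union (Set.disjoint_sdiff_right) hannm, Set.union_sdiff_cancel hS'S]
    rw [hS, hS', volume_wallSlice ρ hρ, volume_wallSlice ρ' hρ'0] at hu
    have h1 : volume ann = ENNReal.ofReal (Real.pi * ρ ^ 2) - ENNReal.ofReal (Real.pi * ρ' ^ 2) :=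
      (ENNReal.sub_eq_of_eq_add_rev ENNReal.ofReal_ne_top hu).symm
    rw [h1, ← ENNReal.ofReal_sub _ (by positivity), ENNReal.toReal_ofReal]
    nlinarith [mul_le_mul_of_nonneg_left (pow_le_pow_left₀ hρ'0 hρ'ρ 2) hπ0]
  have hannle : (volume ann).toReal ≤ 2 * Real.pi * ρ * d := by
    rw [hvolann, hρ']; nlinarith [mul_nonneg hπ0 (sq_nonneg d)]
  -- assemble
  have hmain : 2 * ∑' ij, f S ij ≤ (T₁.card : ℝ) + T₂.card + 2 * Real.sqrt 2 * (2 * Real.pi * ρ * d) := by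
    rw [hQ, mul_add]
    have h1 : 2 * ∑' ij, f S' ij ≤ (T₁.card : ℝ) + T₂.card := by
      simp only [hf] at hflux ⊢; linarith
    have h2 : 2 * ∑' ij, f ann ij ≤ 2 * Real.sqrt 2 * (2 * Real.pi * ρ * d) := by
      simp only [hf] at hA ⊢
      exact hA.trans (mul_le_mul_of_nonneg_left hannle (by positivity))
    linarith
  have hconst : 2 * Real.sqrt 2 * (2 * Real.pi * ρ * d) ≤ 80 * (R₀ + 9) * (1 + h) * ρ := by
    have : 2 * Real.sqrt 2 * (2 * Real.pi * ρ * d) = (4 * Real.sqrt 2 * Real.pi) * d * ρ := by ring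
    rw [this]
    have h5 : (4 * Real.sqrt 2 * Real.pi) * d ≤ 18 * (4 * (R₀ + 9) * (1 + h)) := mul_le_mul h418 hdle hd0 (by norm_num)
    nlinarith
  simp only [hf] at hmain
  linarith


/-- **The cell bound with an inner launch disc.**  See the module docstring. -/
theorem cell_charge_le_lines_margin_sel {σ₁ σ₂ : ℤ → ℤ} (hσ₁ : IsHaggSeq σ₁) (hσ₂ : IsHaggSeq σ₂)
    (L₁ L₂ : E3 ≃ₗᵢ[ℝ] E3) (s₁ s₂ : E3) (τ₀ R₀ h ρ : ℝ) (hR₀ : 1 ≤ R₀) (hh : 0 ≤ h) (hρ : 0 ≤ ρ)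
    (c : ℤ → ℤ → ℝ) (hc0 : ∀ i j, 0 ≤ c i j) (hdom : FluxDominated τ₀ L₁ σ₁ L₂ σ₂ c)
    {step₁ : ℤ → E3} (hsel₁ : IsZigSelector L₁ σ₁ e₃ step₁) {step₂ : ℤ → E3} (hsel₂ : IsZigSelector L₂ σ₂ (-e₃) step₂)
    (m : ℝ) (hm : 0 ≤ m) (T₁ T₂ : Finset (Fin 2 → ℤ))
    (hT₁ : ∀ t : Fin 2 → ℤ, (∃ k : ℤ,
        -R₀ - 4 ≤ (L₁ (zigVertexS step₁ k + ((t 0 : ℝ) • triangularVec₁ 1 + (t 1 : ℝ) • triangularVec₂ 1)) + s₁) 2 ∧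
        (L₁ (zigVertexS step₁ k + ((t 0 : ℝ) • triangularVec₁ 1 + (t 1 : ℝ) • triangularVec₂ 1)) + s₁) 2 ≤ -R₀ - 3 ∧
        Real.sqrt ((L₁ (zigVertexS step₁ k + ((t 0 : ℝ) • triangularVec₁ 1 + (t 1 : ℝ) • triangularVec₂ 1)) + s₁) 0 ^ 2 +
          (L₁ (zigVertexS step₁ k + ((t 0 : ℝ) • triangularVec₁ 1 + (t 1 : ℝ) • triangularVec₂ 1)) + s₁) 1 ^ 2) ≤ ρ - m) →
        t ∈ T₁)
    (hT₂ : ∀ t : Fin 2 → ℤ, (∃ k : ℤ,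
        h + R₀ + 3 ≤ (L₂ (zigVertexS step₂ k + ((t 0 : ℝ) • triangularVec₁ 1 + (t 1 : ℝ) • triangularVec₂ 1)) + s₂) 2 ∧
        (L₂ (zigVertexS step₂ k + ((t 0 : ℝ) • triangularVec₁ 1 + (t 1 : ℝ) • triangularVec₂ 1)) + s₂) 2 ≤ h + R₀ + 4 ∧
        Real.sqrt ((L₂ (zigVertexS step₂ k + ((t 0 : ℝ) • triangularVec₁ 1 + (t 1 : ℝ) • triangularVec₂ 1)) + s₂) 0 ^ 2 +
          (L₂ (zigVertexS step₂ k + ((t 0 : ℝ) • triangularVec₁ 1 + (t 1 : ℝ) • triangularVec₂ 1)) + s₂) 1 ^ 2) ≤ ρ - m) →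
        t ∈ T₂) :
    2 * ∑' ij : ℤ × ℤ, c ij.1 ij.2 * (volume (wallSlice ρ ∩ laySlab L₁ s₁ ij.1 ∩ laySlab L₂ s₂ ij.2)).toReal ≤
      (T₁.card : ℝ) + T₂.card + 80 * (R₀ + 9) * (1 + h) * ρ + 18 * m * ρ := by
  have he₃ : ‖(e₃ : E3)‖ = 1 := by rw [e₃, PiLp.norm_single, norm_one]
  have hne₃ : ‖(-e₃ : E3)‖ = 1 := by rw [norm_neg, he₃]
  have hcB : ∀ i j, c i j ≤ Real.sqrt 2 := fun i j =>
    (hdom i j).trans (by linarith [plateFlux_le_sqrt_two τ₀ L₁ σ₁ he₃ i, plateFlux_le_sqrt_two τ₀ L₂ σ₂ hne₃ j])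
  have hs2 : 0 ≤ Real.sqrt 2 := Real.sqrt_nonneg 2
  have h418 := four_sqrt_two_pi_le
  have hπ0 := Real.pi_pos.le
  have hT0 : (0 : ℝ) ≤ (T₁.card : ℝ) + T₂.card := by positivity
  have hR9 : (0 : ℝ) ≤ 80 * (R₀ + 9) * (1 + h) * ρ := by
    have : 0 ≤ R₀ + 9 := by linarith
    positivity
  have hSfin : ∀ r, 0 ≤ r → volume (wallSlice r) ≠ ⊤ := fun r hr => by rw [volume_wallSlice r hr]; exact ENNReal.ofReal_ne_top
  by_cases hsmall : ρ ≤ m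
  · -- the whole slice is margin
    have h1 := two_charge_le_const L₁ L₂ s₁ s₂ c (Real.sqrt 2) hc0 hcB (wallSlice ρ) (measurableSet_wallSlice ρ) (hSfin ρ hρ)
    rw [volume_wallSlice ρ hρ, ENNReal.toReal_ofReal (by positivity)] at h1
    have h2 : Real.pi * ρ ^ 2 ≤ Real.pi * (ρ * m) := mul_le_mul_of_nonneg_left (by nlinarith) hπ0
    have h3 : 2 * Real.sqrt 2 * (Real.pi * (ρ * m)) ≤ 18 * m * ρ := by
      have : 2 * Real.sqrt 2 * (Real.pi * (ρ * m)) = (2 * Real.sqrt 2 * Real.pi) * (m * ρ) := by ring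
      rw [this]
      have h4 : 2 * Real.sqrt 2 * Real.pi ≤ 9 := by linarith
      nlinarith [mul_nonneg hm hρ]
    nlinarith [mul_le_mul_of_nonneg_left h2 (by positivity : 0 ≤ 2 * Real.sqrt 2)]
  push Not at hsmall
  set ρ' : ℝ := ρ - m with hρ'
  have hρ'0 : 0 ≤ ρ' := by rw [hρ']; linarith
  have hρ'ρ : ρ' ≤ ρ := by rw [hρ']; linarith
  -- the inner slice: the cell bound at radius `ρ'`
  have hinner := cell_charge_le_lines_sel hσ₁ hσ₂ L₁ L₂ s₁ s₂ τ₀ R₀ h ρ' hR₀ hh hρ'0 c hc0 hdom hsel₁ hsel₂ T₁ T₂ hT₁ hT₂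
  -- split the charge into inner slice and margin annulus
  set S : Set E3 := wallSlice ρ with hS
  set S' : Set E3 := wallSlice ρ' with hS'
  set ann : Set E3 := S \ S' with hann
  have hS'S : S' ⊆ S := wallSlice_mono hρ'ρ hρ'0
  have hSm : MeasurableSet S := measurableSet_wallSlice ρ
  have hS'm : MeasurableSet S' := measurableSet_wallSlice ρ'
  have hannm : MeasurableSet ann := hSm.diff hS'm
  have hannfin : volume ann ≠ ⊤ := ne_top_of_le_ne_top (hSfin ρ hρ) (measure_mono Set.sdiff_subset)
  set f : Set E3 → ℤ × ℤ → ℝ := fun X ij => c ij.1 ij.2 * (volume (X ∩ laySlab L₁ s₁ ij.1 ∩ laySlab L₂ s₂ ij.2)).toReal with hf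
  have hsplit : ∀ ij, f S ij = f S' ij + f ann ij := by
    intro ij
    simp only [hf]
    have hset : S ∩ laySlab L₁ s₁ ij.1 ∩ laySlab L₂ s₂ ij.2 =
        (S' ∩ laySlab L₁ s₁ ij.1 ∩ laySlab L₂ s₂ ij.2) ∪ (ann ∩ laySlab L₁ s₁ ij.1 ∩ laySlab L₂ s₂ ij.2) := by
      rw [← Set.union_inter_distrib_right, ← Set.union_inter_distrib_right, hann, Set.union_sdiff_cancel hS'S]
    have hdisj : Disjoint (S' ∩ laySlab L₁ s₁ ij.1 ∩ laySlab L₂ s₂ ij.2) (ann ∩ laySlab L₁ s₁ ij.1 ∩ laySlab L₂ s₂ ij.2) :=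
      (Set.disjoint_sdiff_right).mono (Set.inter_subset_left.trans Set.inter_subset_left)
        (Set.inter_subset_left.trans Set.inter_subset_left)
    rw [hset, measure_union hdisj ((hannm.inter (measurableSet_laySlab L₁ s₁ _)).inter (measurableSet_laySlab L₂ s₂ _)),
      ENNReal.toReal_add (ne_top_of_le_ne_top (hSfin ρ' hρ'0) (measure_mono (Set.inter_subset_left.trans Set.inter_subset_left)))
        (ne_top_of_le_ne_top hannfin (measure_mono (Set.inter_subset_left.trans Set.inter_subset_left))), mul_add]
  have hsumS' := summable_charge L₁ L₂ s₁ s₂ c (Real.sqrt 2) hc0 hcB S' hS'm (hSfin ρ' hρ'0)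
  have hsumA := summable_charge L₁ L₂ s₁ s₂ c (Real.sqrt 2) hc0 hcB ann hannm hannfin
  have hQ : ∑' ij, f S ij = ∑' ij, f S' ij + ∑' ij, f ann ij := by
    rw [← hsumS'.tsum_add hsumA]; exact tsum_congr hsplit
  -- the margin annulus at `√2` per unit volume
  have hA := two_charge_le_const L₁ L₂ s₁ s₂ c (Real.sqrt 2) hc0 hcB ann hannm hannfin
  have hvolann : (volume ann).toReal = Real.pi * ρ ^ 2 - Real.pi * ρ' ^ 2 := by
    have hu : volume S = volume S' + volume ann := by
      rw [← measure_union (Set.disjoint_sdiff_right) hannm, Set.union_sdiff_cancel hS'S]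
    rw [hS, hS', volume_wallSlice ρ hρ, volume_wallSlice ρ' hρ'0] at hu
    have h1 : volume ann = ENNReal.ofReal (Real.pi * ρ ^ 2) - ENNReal.ofReal (Real.pi * ρ' ^ 2) :=
      (ENNReal.sub_eq_of_eq_add_rev ENNReal.ofReal_ne_top hu).symm
    rw [h1, ← ENNReal.ofReal_sub _ (by positivity), ENNReal.toReal_ofReal]
    nlinarith [mul_le_mul_of_nonneg_left (pow_le_pow_left₀ hρ'0 hρ'ρ 2) hπ0]
  have hannle : (volume ann).toReal ≤ 2 * Real.pi * ρ * m := by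
    rw [hvolann, hρ']; nlinarith [mul_nonneg hπ0 (sq_nonneg m)]
  have h1 : 2 * ∑' ij, f S' ij ≤ (T₁.card : ℝ) + T₂.card + 80 * (R₀ + 9) * (1 + h) * ρ' := by
    simp only [hf] at hinner ⊢; exact hinner
  have h2 : 2 * ∑' ij, f ann ij ≤ 2 * Real.sqrt 2 * (2 * Real.pi * ρ * m) := by
    simp only [hf] at hA ⊢
    exact hA.trans (mul_le_mul_of_nonneg_left hannle (by positivity))
  have hconst : 2 * Real.sqrt 2 * (2 * Real.pi * ρ * m) ≤ 18 * m * ρ := by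
    have : 2 * Real.sqrt 2 * (2 * Real.pi * ρ * m) = (4 * Real.sqrt 2 * Real.pi) * (m * ρ) := by ring
    rw [this]; nlinarith [mul_nonneg hm hρ]
  have hρ'le : 80 * (R₀ + 9) * (1 + h) * ρ' ≤ 80 * (R₀ + 9) * (1 + h) * ρ := by
    have : 0 ≤ 80 * (R₀ + 9) * (1 + h) := by
      have : 0 ≤ R₀ + 9 := by linarith
      positivity
    exact mul_le_mul_of_nonneg_left hρ'ρ this
  have hmain : 2 * ∑' ij, f S ij ≤ (T₁.card : ℝ) + T₂.card + 80 * (R₀ + 9) * (1 + h) * ρ + 18 * m * ρ := by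
    rw [hQ, mul_add]; linarith
  simp only [hf] at hmain
  exact hmain

end Summit.Ventures.Crystal3D.Theorems

end
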